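import Summits.RiemannHypothesis.RiemannHypothesis.Theorems.GroundBartaPolarPerronFrobeniusTruncatedConeGap
import Summits.RiemannHypothesis.RiemannHypothesis.Theorems.GroundBartaPolarPerronFrobeniusPolarLoss
import Literature.NumberTheory.LFunctions.WeilArchimedeanPositivityProofs
import HarnessLib

/-!
# RiemannHypothesis / GroundBarta — crux `PolarPerronFrobenius` (stmt-RiemannHypothesis-18390):
# the PRIME-TRUNCATION BARRIER, part 4a — the ROBUST cone gap (almost one-signed tests)

Helper file (`--supports`), RH-free, Mathlib + proved tree files only, no definitions.

Part 1 (`pt_weilFinitePrimeQuadratic_ge_of_nonneg`) bounds every finite-prime form `E_N` from below on real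
NON-NEGATIVE tests by `F_N ‖g‖₂²`, `F_N = ψ(1/4) − log π + 24/5 − 2Ψ_N`.  Here the same mechanism is run for an
ARBITRARY (complex, sign-changing) Weil test `g` supported in `[−a, a]`, keeping track of the defect
`η(g) = ∫ ((Re g)⁻ + |Im g|)` — the `L¹` distance of `g` from the cone of real non-negative functions:

`E_N(g) ≥ F_N ‖g‖₂² − 8(e^a + 1) ‖g‖₁ η(g)` (`pt_robust_cone_gap`).

(Transform `|ĝ(1/2+it)| ≤ ‖g‖₁`; polar `≥ 2(∫(Re g)⁺)² − 4e^a ‖g‖₁ η − 2e^a η²` by splitting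
`Re g = (Re g)⁺ − (Re g)⁻` and Cauchy–Schwarz on `(Re g)⁺`; two Lorentzians `≤ ‖g‖₁²` each.)  Along an
`L²`-convergent minimising sequence with a one-signed limit `η → 0`, so part 4b (Theorems/…TruncatedNoOneSignedBottom)
concludes that NO finite-prime truncation has a one-signed bottom state at any large window.
Prover B, speedrun unit `sr-gb-rung-b` (rung 3).

References: H. Yoshida, Adv. Stud. Pure Math. 21 (1992) §2 (2.1), §6; E. Bombieri, Rend. Lincei (9) 11 (2000) Thm 2.
-/

set_option linter.dupNamespace false

noncomputable section

open Set MeasureTheory Filter Complex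
open scoped Real Topology ComplexConjugate

namespace Summit.RiemannHypothesis.RiemannHypothesis.Theorems.PolarPerronFrobenius

open Literature.NumberTheory.LFunctions Literature.Analysis.SpecialFunctions

variable {g : ℝ → ℂ} {a : ℝ}

/-! ## Transform and Lorentzians against the `L¹` norm -/

/-- `‖ĝ(1/2 + it)‖ ≤ ‖g‖₁` for every test. [folklore] -/
theorem pt_norm_weilMellin_half_line_le_weilNorm1 (g : ℝ → ℂ) (t : ℝ) :
    ‖weilMellin g (1 / 2 + t * I)‖ ≤ ∫ x : ℝ, ‖g x‖ := by
  unfold weilMellin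
  refine (norm_integral_le_integral_norm _).trans (le_of_eq ?_)
  congr 1 with x
  rw [norm_mul, show ((1 / 2 : ℂ) + t * I - 1 / 2) * x = ((t * x : ℝ) : ℂ) * I by push_cast; ring,
    Complex.norm_exp_ofReal_mul_I, mul_one]

/-- Each Lorentzian costs at most `‖g‖₁²`:
`(1/2π) ∫ ‖ĝ(1/2+it)‖² · 2l/(l²+t²) dt ≤ ‖g‖₁²`. [folklore] -/
theorem pt_integral_norm_sq_mul_lorentzian_le_weilNorm1 (hg : IsWeilTest g) {l : ℝ} (hl : 0 < l) :
    1 / (2 * π) * ∫ t : ℝ, ‖weilMellin g (1 / 2 + t * I)‖ ^ 2 * (2 * l / (l ^ 2 + t ^ 2)) ≤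
      (∫ x : ℝ, ‖g x‖) ^ 2 := by
  set p := ∫ x : ℝ, ‖g x‖
  have hp0 : 0 ≤ p := integral_nonneg fun x ↦ norm_nonneg _
  have hw : ∀ t : ℝ, 0 ≤ 2 * l / (l ^ 2 + t ^ 2) := fun t ↦ by positivity
  have hle : ∫ t : ℝ, ‖weilMellin g (1 / 2 + t * I)‖ ^ 2 * (2 * l / (l ^ 2 + t ^ 2)) ≤
      ∫ t : ℝ, p ^ 2 * (2 * l / (l ^ 2 + t ^ 2)) := by
    refine integral_mono ?_ ((pt_integrable_lorentzian hl).const_mul _) fun t ↦ ?_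
    · refine integrable_norm_sq_weilMellin_mul hg (by fun_prop) (A := 2 / l) (B := 0)
        (by positivity) le_rfl fun t ↦ ?_
      rw [abs_of_nonneg (hw t), zero_mul, add_zero, div_le_div_iff₀ (by positivity) hl]
      nlinarith [sq_nonneg t]
    · exact mul_le_mul_of_nonneg_right
        (pow_le_pow_left₀ (norm_nonneg _) (pt_norm_weilMellin_half_line_le_weilNorm1 g t) 2) (hw t)
  rw [integral_const_mul, pt_integral_lorentzian hl] at hle
  have hpi : 0 < 2 * π := by positivity
  calc 1 / (2 * π) * ∫ t : ℝ, ‖weilMellin g (1 / 2 + t * I)‖ ^ 2 * (2 * l / (l ^ 2 + t ^ 2))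
      ≤ 1 / (2 * π) * (p ^ 2 * (2 * π)) := mul_le_mul_of_nonneg_left hle (by positivity)
    _ = p ^ 2 := by field_simp

/-- **The archimedean part against the `L¹` norm**:
`(1/2π)∫‖ĝ‖² w_N ≥ (ψ(1/4) + 24/5 − 2Ψ_N)‖g‖₂² − 2‖g‖₁²` for every test. [cite: Yoshida1992, §6 (vertical series)] -/
theorem pt_arch_ge_weilNorm1 (N : ℕ) (hg : IsWeilTest g) :
    (reDigammaQuarter 0 + 24 / 5 -
        2 * (∑ n ∈ Finset.range (N + 1), (ArithmeticFunction.vonMangoldt n : ℝ) / Real.sqrt n)) *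
        weilNorm2Sq g - 2 * (∫ x : ℝ, ‖g x‖) ^ 2 ≤
      1 / (2 * π) * ∫ t : ℝ, ‖weilMellin g (1 / 2 + t * I)‖ ^ 2 * weilFinitePrimeWeight N t := by
  set Ψ := ∑ n ∈ Finset.range (N + 1), (ArithmeticFunction.vonMangoldt n : ℝ) / Real.sqrt n with hΨ
  set K := reDigammaQuarter 0 + 24 / 5 - 2 * Ψ with hK
  set F : ℝ → ℝ := fun t ↦ ‖weilMellin g (1 / 2 + t * I)‖ ^ 2 with hF
  have hl0 : (0 : ℝ) < 1 / 2 := by norm_num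
  have hl1 : (0 : ℝ) < 5 / 2 := by norm_num
  have hiF : Integrable F := integrable_norm_sq_weilMellin_half_line hg
  have hiW : Integrable fun t ↦ F t * weilFinitePrimeWeight N t :=
    integrable_norm_sq_weilMellin_mul_weilFinitePrimeWeight hg N
  have hiL : ∀ {l : ℝ}, 0 < l → Integrable fun t ↦ F t * (2 * l / (l ^ 2 + t ^ 2)) := by
    intro l hl
    refine integrable_norm_sq_weilMellin_mul hg (by fun_prop) (A := 2 / l) (B := 0)
      (by positivity) le_rfl fun t ↦ ?_
    have hw : 0 ≤ 2 * l / (l ^ 2 + t ^ 2) := by positivity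
    rw [abs_of_nonneg hw, zero_mul, add_zero, div_le_div_iff₀ (by positivity) hl]
    nlinarith [sq_nonneg t]
  have hpt : ∀ t, F t * K - F t * (2 * (1 / 2 : ℝ) / ((1 / 2 : ℝ) ^ 2 + t ^ 2)) -
      F t * (2 * (5 / 2 : ℝ) / ((5 / 2 : ℝ) ^ 2 + t ^ 2)) ≤ F t * weilFinitePrimeWeight N t := by
    intro t
    have h := pt_weilFinitePrimeWeight_ge N t
    rw [← mul_sub, ← mul_sub]
    exact mul_le_mul_of_nonneg_left h (sq_nonneg _)
  have hmono : ∫ t, (F t * K - F t * (2 * (1 / 2 : ℝ) / ((1 / 2 : ℝ) ^ 2 + t ^ 2)) -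
      F t * (2 * (5 / 2 : ℝ) / ((5 / 2 : ℝ) ^ 2 + t ^ 2))) ≤ ∫ t, F t * weilFinitePrimeWeight N t :=
    integral_mono (((hiF.mul_const K).sub (hiL hl0)).sub (hiL hl1)) hiW hpt
  have hsplit : ∫ t, (F t * K - F t * (2 * (1 / 2 : ℝ) / ((1 / 2 : ℝ) ^ 2 + t ^ 2)) -
      F t * (2 * (5 / 2 : ℝ) / ((5 / 2 : ℝ) ^ 2 + t ^ 2))) =
      2 * π * weilNorm2Sq g * K - (∫ t, F t * (2 * (1 / 2 : ℝ) / ((1 / 2 : ℝ) ^ 2 + t ^ 2))) -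
        ∫ t, F t * (2 * (5 / 2 : ℝ) / ((5 / 2 : ℝ) ^ 2 + t ^ 2)) := by
    rw [integral_sub, integral_sub, integral_mul_const, integral_norm_sq_weilMellin_half_line hg]
    all_goals first
      | exact (hiF.mul_const K).sub (hiL hl0)
      | exact hiF.mul_const K
      | exact hiL hl0
      | exact hiL hl1
  rw [hsplit] at hmono
  have hL0 := pt_integral_norm_sq_mul_lorentzian_le_weilNorm1 hg hl0
  have hL1 := pt_integral_norm_sq_mul_lorentzian_le_weilNorm1 hg hl1
  have hpi : 0 < 2 * π := by positivity
  have := mul_le_mul_of_nonneg_left hmono (le_of_lt (one_div_pos.2 hpi))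
  rw [mul_sub, mul_sub, show 1 / (2 * π) * (2 * π * weilNorm2Sq g * K) = K * weilNorm2Sq g by
    field_simp] at this
  linarith

/-! ## The polar term of a sign-changing complex test -/

/-- Cauchy–Schwarz for the polar weights, for any continuous compactly supported `f ≥ 0`:
`(∫ f)² ≤ (∫ f e^{-x/2})(∫ f e^{x/2})`. [folklore] -/
theorem pt_sq_integral_le_of_nonneg {f : ℝ → ℝ} (hfc : Continuous f) (hfs : HasCompactSupport f)
    (hf : ∀ x, 0 ≤ f x) :
    (∫ x : ℝ, f x) ^ 2 ≤ (∫ x : ℝ, f x * Real.exp (-(x / 2))) * (∫ x : ℝ, f x * Real.exp (x / 2)) := by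
  set A := ∫ x : ℝ, f x * Real.exp (-(x / 2)) with hA
  set B := ∫ x : ℝ, f x * Real.exp (x / 2) with hB
  set s := ∫ x : ℝ, f x with hs
  have hint : ∀ {φ : ℝ → ℝ}, Continuous φ → Integrable fun x ↦ f x * φ x := fun hφ ↦
    (hfc.mul hφ).integrable_of_hasCompactSupport hfs.mul_right
  have hiA := hint (φ := fun x ↦ Real.exp (-(x / 2))) (by fun_prop)
  have hiB := hint (φ := fun x ↦ Real.exp (x / 2)) (by fun_prop)
  have his : Integrable f := by simpa using hint (φ := fun _ ↦ (1 : ℝ)) continuous_const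
  have key : ∀ c : ℝ, 0 ≤ A * (c * c) + (-2 * s) * c + B := by
    intro c
    have hpt : ∀ x : ℝ, f x * (c * Real.exp (-(x / 4)) - Real.exp (x / 4)) ^ 2 =
        c * c * (f x * Real.exp (-(x / 2))) - 2 * c * f x + f x * Real.exp (x / 2) := by
      intro x
      have h1 : Real.exp (-(x / 4)) * Real.exp (x / 4) = 1 := by rw [← Real.exp_add]; simp
      have h2 : Real.exp (-(x / 4)) ^ 2 = Real.exp (-(x / 2)) := by rw [sq, ← Real.exp_add]; ring_nf
      have h3 : Real.exp (x / 4) ^ 2 = Real.exp (x / 2) := by rw [sq, ← Real.exp_add]; ring_nf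
      have : (c * Real.exp (-(x / 4)) - Real.exp (x / 4)) ^ 2 =
          c * c * Real.exp (-(x / 4)) ^ 2 - 2 * c * (Real.exp (-(x / 4)) * Real.exp (x / 4)) +
            Real.exp (x / 4) ^ 2 := by ring
      rw [this, h1, h2, h3]; ring
    have hnn : 0 ≤ ∫ x : ℝ, f x * (c * Real.exp (-(x / 4)) - Real.exp (x / 4)) ^ 2 :=
      integral_nonneg fun x ↦ mul_nonneg (hf x) (sq_nonneg _)
    simp_rw [hpt] at hnn
    rw [integral_add, integral_sub, integral_const_mul, integral_const_mul] at hnn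
    · linarith
    all_goals first
      | exact (hiA.const_mul _).sub (his.const_mul _)
      | exact hiA.const_mul _
      | exact his.const_mul _
      | exact hiB
  have hd := discrim_le_zero key
  rw [discrim] at hd
  nlinarith

/-- Real/imaginary splitting of the transform at a real point:
`ĝ(σ) = ∫ Re g · e^{(σ−1/2)t} + i ∫ Im g · e^{(σ−1/2)t}`. [folklore] -/
theorem pt_weilMellin_ofReal_eq (hg : IsWeilTest g) (σ : ℝ) :
    weilMellin g (σ : ℂ) = ((∫ t : ℝ, (g t).re * Real.exp ((σ - 1 / 2) * t) : ℝ) : ℂ) +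
      ((∫ t : ℝ, (g t).im * Real.exp ((σ - 1 / 2) * t) : ℝ) : ℂ) * I := by
  unfold weilMellin
  have hφ : Continuous fun t : ℝ ↦ Real.exp ((σ - 1 / 2) * t) := by fun_prop
  have hi1 : Integrable fun t : ℝ ↦ (((g t).re * Real.exp ((σ - 1 / 2) * t) : ℝ) : ℂ) :=
    (pt_integrable_re_mul hg hφ).ofReal
  have hi2' : Integrable fun t : ℝ ↦ (g t).im * Real.exp ((σ - 1 / 2) * t) := by
    refine Continuous.integrable_of_hasCompactSupport ((Complex.continuous_im.comp hg.1.continuous).mul hφ) ?_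
    exact (hg.2.comp_left (g := Complex.im) Complex.zero_im).mul_right
  have hi2 : Integrable fun t : ℝ ↦ (((g t).im * Real.exp ((σ - 1 / 2) * t) : ℝ) : ℂ) * I :=
    hi2'.ofReal.mul_const I
  have e : (fun t : ℝ ↦ g t * cexp (((σ : ℂ) - 1 / 2) * t)) = fun t ↦
      (((g t).re * Real.exp ((σ - 1 / 2) * t) : ℝ) : ℂ) +
        (((g t).im * Real.exp ((σ - 1 / 2) * t) : ℝ) : ℂ) * I := by
    funext t
    have hexp : cexp (((σ : ℂ) - 1 / 2) * t) = ((Real.exp ((σ - 1 / 2) * t) : ℝ) : ℂ) := by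
      rw [Complex.ofReal_exp]; push_cast; ring_nf
    rw [hexp]
    conv_lhs => rw [← Complex.re_add_im (g t)]
    push_cast
    ring
  rw [e, integral_add hi1 hi2, integral_mul_const, integral_complex_ofReal, integral_complex_ofReal]

/-- `|∫ w φ| ≤ c ∫ |w|` when `|φ| ≤ c` on `[-a, a] ⊇ supp w` (`w` continuous, compactly supported). [folklore] -/
theorem pt_abs_integral_mul_le {w : ℝ → ℝ} (hwc : Continuous w) (hws : HasCompactSupport w)
    (hsupp : Function.support w ⊆ Icc (-a) a) {φ : ℝ → ℝ} (hφ : Continuous φ) {c : ℝ}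
    (hφc : ∀ t ∈ Icc (-a) a, |φ t| ≤ c) :
    |∫ t, w t * φ t| ≤ c * ∫ t, |w t| := by
  have hi : Integrable fun t ↦ |w t| * |φ t| :=
    (hwc.abs.mul hφ.abs).integrable_of_hasCompactSupport hws.abs.mul_right
  calc |∫ t, w t * φ t| ≤ ∫ t, |w t * φ t| := abs_integral_le_integral_abs
    _ = ∫ t, |w t| * |φ t| := by congr 1 with t; rw [abs_mul]
    _ ≤ ∫ t, c * |w t| := by
        refine integral_mono hi ((hwc.abs.integrable_of_hasCompactSupport hws.abs).const_mul c) fun t ↦ ?_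
        by_cases ht : t ∈ Icc (-a) a
        · dsimp only; rw [mul_comm c]
          exact mul_le_mul_of_nonneg_left (hφc t ht) (abs_nonneg _)
        · have h0 : w t = 0 := by
            by_contra h
            exact ht (hsupp (Function.mem_support.2 h))
          simp [h0]
    _ = c * ∫ t, |w t| := integral_const_mul _ _

/-- On `[-a, a]`: `|e^{±t/2}| ≤ e^{a/2}`. [folklore] -/
theorem pt_abs_exp_half_le {a t : ℝ} (ht : t ∈ Icc (-a) a) (ε : ℝ) (hε : ε = 1 ∨ ε = -1) :
    |Real.exp (ε * (t / 2))| ≤ Real.exp (a / 2) := by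
  rw [abs_of_pos (Real.exp_pos _), Real.exp_le_exp]
  rcases hε with h | h <;> · subst h; have := ht.1; have := ht.2; linarith

/-- **Robust polar lower bound.** For a Weil test `g` supported in `[-a, a]`, with
`P = ∫ (Re g)⁺`, `m₁ = ∫ (Re g)⁻`, `m₂ = ∫ |Im g|`:
`2Re(ĝ(0) conj ĝ(1)) ≥ 2P² − 4e^a P m₁ − 2 e^a m₂²`. [cite: Yoshida1992, §6 eq. (6.2)] -/
theorem pt_polar_ge_robust (hg : IsWeilTest g) (hsupp : tsupport g ⊆ Icc (-a) a) :
    2 * (∫ t, max ((g t).re) 0) ^ 2 -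
        4 * Real.exp a * (∫ t, max ((g t).re) 0) * (∫ t, max (-(g t).re) 0) -
        2 * Real.exp a * (∫ t, |(g t).im|) ^ 2 ≤
      2 * (weilMellin g 0 * conj (weilMellin g 1)).re := by
  set u : ℝ → ℝ := fun t ↦ (g t).re with hu
  set v : ℝ → ℝ := fun t ↦ (g t).im with hv
  have huc : Continuous u := Complex.continuous_re.comp hg.1.continuous
  have hvc : Continuous v := Complex.continuous_im.comp hg.1.continuous
  have hus : HasCompactSupport u := hg.2.comp_left (g := Complex.re) Complex.zero_re
  have hvs : HasCompactSupport v := hg.2.comp_left (g := Complex.im) Complex.zero_im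
  have hsupp' : Function.support g ⊆ Icc (-a) a := (subset_tsupport g).trans hsupp
  have husupp : Function.support u ⊆ Icc (-a) a := fun t ht ↦ hsupp' (by
    rw [Function.mem_support] at ht ⊢; intro h; exact ht (by simp [hu, h]))
  have hnusupp : Function.support (fun t ↦ -u t) ⊆ Icc (-a) a := fun t ht ↦ husupp (by
    rw [Function.mem_support] at ht ⊢; intro h; exact ht (by simp [h]))
  have hvsupp : Function.support v ⊆ Icc (-a) a := fun t ht ↦ hsupp' (by
    rw [Function.mem_support] at ht ⊢; intro h; exact ht (by simp [hv, h]))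
  have hφ0 : Continuous fun t : ℝ ↦ Real.exp (((0 : ℝ) - 1 / 2) * t) := by fun_prop
  have hφ1 : Continuous fun t : ℝ ↦ Real.exp (((1 : ℝ) - 1 / 2) * t) := by fun_prop
  have hb0 : ∀ t ∈ Icc (-a) a, |Real.exp (((0 : ℝ) - 1 / 2) * t)| ≤ Real.exp (a / 2) := fun t ht ↦ by
    have := pt_abs_exp_half_le ht (-1) (Or.inr rfl); convert this using 3; ring
  have hb1 : ∀ t ∈ Icc (-a) a, |Real.exp (((1 : ℝ) - 1 / 2) * t)| ≤ Real.exp (a / 2) := fun t ht ↦ by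
    have := pt_abs_exp_half_le ht 1 (Or.inl rfl); convert this using 3; ring
  have hb0' : ∀ t ∈ Icc (-a) a, Real.exp (((0 : ℝ) - 1 / 2) * t) ≤ Real.exp (a / 2) := fun t ht ↦
    (le_abs_self _).trans (hb0 t ht)
  have hb1' : ∀ t ∈ Icc (-a) a, Real.exp (((1 : ℝ) - 1 / 2) * t) ≤ Real.exp (a / 2) := fun t ht ↦
    (le_abs_self _).trans (hb1 t ht)
  set P := ∫ t, max (u t) 0 with hP
  set m₁ := ∫ t, max (-u t) 0 with hm₁
  set m₂ := ∫ t, |v t| with hm₂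
  set Ap := ∫ t, max (u t) 0 * Real.exp (((0 : ℝ) - 1 / 2) * t) with hAp
  set Am := ∫ t, max (-u t) 0 * Real.exp (((0 : ℝ) - 1 / 2) * t) with hAm
  set A' := ∫ t, v t * Real.exp (((0 : ℝ) - 1 / 2) * t) with hA'
  set Bp := ∫ t, max (u t) 0 * Real.exp (((1 : ℝ) - 1 / 2) * t) with hBp
  set Bm := ∫ t, max (-u t) 0 * Real.exp (((1 : ℝ) - 1 / 2) * t) with hBm
  set B' := ∫ t, v t * Real.exp (((1 : ℝ) - 1 / 2) * t) with hB'
  have hP0 : 0 ≤ P := integral_nonneg fun t ↦ le_max_right _ _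
  have hm₁0 : 0 ≤ m₁ := integral_nonneg fun t ↦ le_max_right _ _
  have hm₂0 : 0 ≤ m₂ := integral_nonneg fun t ↦ abs_nonneg _
  have hea : 0 ≤ Real.exp (a / 2) := (Real.exp_pos _).le
  have hcast : ∀ (φ : ℝ → ℝ), (fun t ↦ ((u t : ℝ) : ℂ) * ((φ t : ℝ) : ℂ)) =
      fun t ↦ (((u t * φ t : ℝ)) : ℂ) := fun φ ↦ by funext t; push_cast; ring
  have hA : (∫ t, u t * Real.exp (((0 : ℝ) - 1 / 2) * t)) = Ap - Am := by
    have h := sw_integral_self_mul_eq huc hus hφ0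
    rw [hcast, integral_complex_ofReal] at h
    exact Complex.ofReal_injective h
  have hB : (∫ t, u t * Real.exp (((1 : ℝ) - 1 / 2) * t)) = Bp - Bm := by
    have h := sw_integral_self_mul_eq huc hus hφ1
    rw [hcast, integral_complex_ofReal] at h
    exact Complex.ofReal_injective h
  have hM0 : weilMellin g 0 = ((Ap - Am : ℝ) : ℂ) + (A' : ℂ) * I := by
    have h : weilMellin g ((0 : ℝ) : ℂ) = ((∫ t, u t * Real.exp (((0 : ℝ) - 1 / 2) * t) : ℝ) : ℂ) +
        ((∫ t, v t * Real.exp (((0 : ℝ) - 1 / 2) * t) : ℝ) : ℂ) * I := pt_weilMellin_ofReal_eq hg 0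
    rw [Complex.ofReal_zero] at h
    rw [h, hA]
  have hM1 : weilMellin g 1 = ((Bp - Bm : ℝ) : ℂ) + (B' : ℂ) * I := by
    have h : weilMellin g ((1 : ℝ) : ℂ) = ((∫ t, u t * Real.exp (((1 : ℝ) - 1 / 2) * t) : ℝ) : ℂ) +
        ((∫ t, v t * Real.exp (((1 : ℝ) - 1 / 2) * t) : ℝ) : ℂ) * I := pt_weilMellin_ofReal_eq hg 1
    rw [Complex.ofReal_one] at h
    rw [h, hB]
  have hre : (weilMellin g 0 * conj (weilMellin g 1)).re = (Ap - Am) * (Bp - Bm) + A' * B' := by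
    rw [hM0, hM1]
    simp only [map_add, map_mul, map_sub, Complex.conj_ofReal, Complex.conj_I, Complex.add_re,
      Complex.mul_re, Complex.ofReal_re, Complex.ofReal_im, Complex.I_re, Complex.I_im, Complex.mul_im,
      Complex.add_im, Complex.neg_re, Complex.neg_im, Complex.ofReal_sub, Complex.sub_re, Complex.sub_im]
    ring
  have hApP : Ap ≤ Real.exp (a / 2) * P := sw_integral_posPart_mul_le huc hus husupp hφ0 hb0'
  have hBpP : Bp ≤ Real.exp (a / 2) * P := sw_integral_posPart_mul_le huc hus husupp hφ1 hb1'
  have hAm1 : Am ≤ Real.exp (a / 2) * m₁ :=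
    sw_integral_posPart_mul_le (f := fun t ↦ -u t) huc.neg hus.neg hnusupp hφ0 hb0'
  have hBm1 : Bm ≤ Real.exp (a / 2) * m₁ :=
    sw_integral_posPart_mul_le (f := fun t ↦ -u t) huc.neg hus.neg hnusupp hφ1 hb1'
  have hAp0 : 0 ≤ Ap := integral_nonneg fun t ↦ mul_nonneg (le_max_right _ _) (Real.exp_pos _).le
  have hBp0 : 0 ≤ Bp := integral_nonneg fun t ↦ mul_nonneg (le_max_right _ _) (Real.exp_pos _).le
  have hAm0 : 0 ≤ Am := integral_nonneg fun t ↦ mul_nonneg (le_max_right _ _) (Real.exp_pos _).le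
  have hBm0 : 0 ≤ Bm := integral_nonneg fun t ↦ mul_nonneg (le_max_right _ _) (Real.exp_pos _).le
  have hA'b : |A'| ≤ Real.exp (a / 2) * m₂ := pt_abs_integral_mul_le hvc hvs hvsupp hφ0 hb0
  have hB'b : |B'| ≤ Real.exp (a / 2) * m₂ := pt_abs_integral_mul_le hvc hvs hvsupp hφ1 hb1
  have hCS : P ^ 2 ≤ Ap * Bp := by
    have h := pt_sq_integral_le_of_nonneg (f := fun t ↦ max (u t) 0) (huc.max continuous_const)
      ((hus.mono fun t ht ↦ by
        rw [Function.mem_support] at ht ⊢; intro h0; apply ht; rw [h0, max_self])) fun x ↦ le_max_right _ _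
    convert h using 3 <;> funext t <;> ring_nf
  have hexp : Real.exp (a / 2) * Real.exp (a / 2) = Real.exp a := by rw [← Real.exp_add]; ring_nf
  rw [hre]
  have h1 : Ap * Bm ≤ Real.exp a * P * m₁ := by
    calc Ap * Bm ≤ (Real.exp (a / 2) * P) * (Real.exp (a / 2) * m₁) := mul_le_mul hApP hBm1 hBm0 (by positivity)
      _ = Real.exp a * P * m₁ := by rw [← hexp]; ring
  have h2 : Am * Bp ≤ Real.exp a * P * m₁ := by
    calc Am * Bp ≤ (Real.exp (a / 2) * m₁) * (Real.exp (a / 2) * P) := mul_le_mul hAm1 hBpP hBp0 (by positivity)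
      _ = Real.exp a * P * m₁ := by rw [← hexp]; ring
  have h3 : -(Real.exp a * m₂ ^ 2) ≤ A' * B' := by
    have : |A' * B'| ≤ Real.exp a * m₂ ^ 2 := by
      rw [abs_mul]
      calc |A'| * |B'| ≤ (Real.exp (a / 2) * m₂) * (Real.exp (a / 2) * m₂) :=
            mul_le_mul hA'b hB'b (abs_nonneg _) (by positivity)
        _ = Real.exp a * m₂ ^ 2 := by rw [← hexp]; ring
    linarith [neg_abs_le (A' * B')]
  nlinarith [mul_nonneg hAm0 hBm0]

/-! ## The robust cone gap -/

/-- **THE ROBUST CONE GAP.** For every `N`, every window `[-a, a]` and every Weil test `g` supported in it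
(complex-valued, any sign):
`E_N(g) ≥ F_N ‖g‖₂² − 8(e^a + 1) ‖g‖₁ η(g)`, `F_N = ψ(1/4) − log π + 24/5 − 2Ψ_N`,
`η(g) = ∫ ((Re g)⁻ + |Im g|)` (the `L¹` defect from the real non-negative cone).
For `η(g) = 0` this is the cone gap of part 1. [cite: Yoshida1992, §2 eq. (2.1), §6] -/
theorem pt_robust_cone_gap (N : ℕ) (hg : IsWeilTest g) (hsupp : tsupport g ⊆ Icc (-a) a) :
    (reDigammaQuarter 0 - Real.log π + 24 / 5 -
        2 * (∑ n ∈ Finset.range (N + 1), (ArithmeticFunction.vonMangoldt n : ℝ) / Real.sqrt n)) *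
        weilNorm2Sq g -
      8 * (Real.exp a + 1) * (∫ x : ℝ, ‖g x‖) * (∫ t : ℝ, (max (-(g t).re) 0 + |(g t).im|)) ≤
      weilFinitePrimeQuadratic N g := by
  set u : ℝ → ℝ := fun t ↦ (g t).re with hu
  set v : ℝ → ℝ := fun t ↦ (g t).im with hv
  have huc : Continuous u := Complex.continuous_re.comp hg.1.continuous
  have hvc : Continuous v := Complex.continuous_im.comp hg.1.continuous
  have hus : HasCompactSupport u := hg.2.comp_left (g := Complex.re) Complex.zero_re
  have hvs : HasCompactSupport v := hg.2.comp_left (g := Complex.im) Complex.zero_im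
  set p := ∫ x : ℝ, ‖g x‖ with hp
  set P := ∫ t, max (u t) 0 with hP
  set m₁ := ∫ t, max (-u t) 0 with hm₁
  set m₂ := ∫ t, |v t| with hm₂
  have hiP : Integrable fun t ↦ max (u t) 0 := sw_integrable_posPart huc hus
  have him₁ : Integrable fun t ↦ max (-u t) 0 := sw_integrable_posPart (f := fun t ↦ -u t) huc.neg hus.neg
  have him₂ : Integrable fun t ↦ |v t| := hvc.abs.integrable_of_hasCompactSupport hvs.abs
  have hip : Integrable fun t ↦ ‖g t‖ := hg.1.continuous.norm.integrable_of_hasCompactSupport hg.2.norm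
  have hη : ∫ t : ℝ, (max (-(g t).re) 0 + |(g t).im|) = m₁ + m₂ := integral_add him₁ him₂
  have hP0 : 0 ≤ P := integral_nonneg fun t ↦ le_max_right _ _
  have hm₁0 : 0 ≤ m₁ := integral_nonneg fun t ↦ le_max_right _ _
  have hm₂0 : 0 ≤ m₂ := integral_nonneg fun t ↦ abs_nonneg _
  have hp_le : p ≤ P + m₁ + m₂ := by
    have hsum : ∫ t, (max (u t) 0 + max (-u t) 0 + |v t|) = P + m₁ + m₂ := by
      rw [integral_add, integral_add]
      all_goals first
        | exact hiP.add him₁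
        | exact hiP
        | exact him₁
        | exact him₂
    rw [← hsum]
    refine integral_mono hip ((hiP.add him₁).add him₂) fun t ↦ ?_
    have h1 := Complex.norm_le_abs_re_add_abs_im (g t)
    have h2 : |(g t).re| = max (u t) 0 + max (-u t) 0 := by
      rcases le_total 0 (u t) with h | h
      · rw [hu] at h ⊢; rw [abs_of_nonneg h, max_eq_left h, max_eq_right (by linarith), add_zero]
      · rw [hu] at h ⊢; rw [abs_of_nonpos h, max_eq_right h, max_eq_left (by linarith), zero_add]
    dsimp only
    linarith
  have hP_le : P ≤ p := integral_mono hiP hip fun t ↦ by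
    dsimp only
    exact (max_le (Complex.re_le_norm _) (norm_nonneg _))
  have hm₁_le : m₁ ≤ p := integral_mono him₁ hip fun t ↦ by
    dsimp only
    refine max_le ?_ (norm_nonneg _)
    have := Complex.neg_re (g t) ▸ Complex.re_le_norm (-g t)
    rwa [norm_neg] at this
  have hm₂_le : m₂ ≤ p := integral_mono him₂ hip fun t ↦ Complex.abs_im_le_norm _
  have hpolar := pt_polar_ge_robust hg hsupp
  have harch := pt_arch_ge_weilNorm1 N hg
  have hea : 1 ≤ Real.exp a ∨ Real.exp a < 1 := le_or_gt 1 (Real.exp a)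
  have he0 : 0 < Real.exp a := Real.exp_pos a
  rw [hη]
  unfold weilFinitePrimeQuadratic
  have h1 : 2 * p ^ 2 - 2 * P ^ 2 ≤ 4 * p * (m₁ + m₂) := by nlinarith
  have h2 : 4 * Real.exp a * P * m₁ ≤ 4 * Real.exp a * p * (m₁ + m₂) := by
    have := mul_le_mul hP_le (le_add_of_nonneg_right hm₂0 : m₁ ≤ m₁ + m₂) hm₁0 (le_trans hP0 hP_le)
    nlinarith
  have h3 : 2 * Real.exp a * m₂ ^ 2 ≤ 2 * Real.exp a * p * (m₁ + m₂) := by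
    have : m₂ ^ 2 ≤ p * (m₁ + m₂) := by nlinarith
    nlinarith
  have h4 : 0 ≤ p * (m₁ + m₂) := mul_nonneg (le_trans hP0 hP_le) (by positivity)
  nlinarith

end Summit.RiemannHypothesis.RiemannHypothesis.Theorems.PolarPerronFrobenius
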